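import Summits.PneNP.PneNP.Theorems.ConstantBand.Negative.LoadBearing
import Literature.Computability.Complexity.RossmanMonotoneCliqueGraphs
import Literature.Computability.Complexity.CliqueThresholdBounds

/-!
# Route OneSlice, crux `ConstantBand` (stmt-PneNP-2834), line `flat-prior-relative-minterms`:
# toolkit for the transfer stub S5 (`stub_transferStep`)

Helper lemmas (prefix `ts_`) for `Theorems/OneSliceConstantBandTransferStep.lean`, stated over the landed
vocabulary of `Theorems/ConstantBand/Negative/LoadBearing.lean` only (`Edge`, `thr`, `Central`, `slice`,
`errSet`; no new definition):

* slice counting, adapted from `Cruxes/ConstantBand/Disproof.lean` §4 (not importable): `ts_card_slice`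
  (`#slice_i = C(C(n,2), i)`), the hypergeometric tail `ts_card_slice_filter_supset_mul_le`
  (`P_i[F ⊆ x] ≤ (i/C(n,2))^{|F|}`) and the FIRST-MOMENT bound `ts_sliceFrac_clique_le`
  (`P_i[CLIQUE_k] ≤ C(n,k)·(i/C(n,2))^{C(k,2)}`, union bound over the `C(n,k)` vertex sets);
* the two counting inequalities the transfer consumes on a slice: `ts_frac_false_clique_le_errFrac`
  (`P_i[C = 0 ∧ CLIQUE_k = 1] ≤ errfrac_i(C)`) and `ts_one_sub_le_frac_false`
  (`1 − C(n,k)(i/C(n,2))^{C(k,2)} − errfrac_i(C) ≤ P_i[C = 0]`);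
* window bookkeeping around `T_k(n) = C(n,2)·n^{-2/(k-1)}` (`thr k n = ⌊T_k(n)⌋₊`): for central `j`,
  `i ≤ j + w ⟹ i ≤ T(1 + T^{-1/4} + w/T)` and `T(1 − T^{-1/4} − 1/T) ≤ j`; `T_k(n) → ∞`, both factors `→ 1`,
  `C(n,k)·n^{-2C(k,2)/(k-1)} ≤ 1/k!`;
* the eventual package `ts_eventually_window`: for `k ≥ 3`, eventually in `n`, for every central `j`:
  `C(k,2) ≤ j`, and every `i ≤ j + w` has `i ≤ C(n,2)` (non-empty slice) and `C(n,k)(i/C(n,2))^{C(k,2)} ≤ 1/3`.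
-/

set_option linter.dupNamespace false

namespace Summit.PneNP.PneNP.Cruxes.ConstantBand.FlatPriorRelativeMinterms

open Literature.Computability.Complexity Finset Filter Classical
open Summit.PneNP.PneNP.Theorems.ConstantBand.Negative
open Literature.Combinatorics.SetFamily (finsetEquivFun mem_finsetEquivFun_symm)
open scoped Topology

variable {n : ℕ}

/-! ## Slice counting -/

-- adapted from Cruxes/ConstantBand/Disproof.lean §4: `ts_finsetEquivFun_symm_eq`, `ts_card_slice`,
-- `ts_card_slice_filter_supset(_mul_le)`, `ts_frac_slice_filter_supset_le`, `ts_sliceFrac_clique_le`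
-- (= the clique part of `errFrac_input_le`), `ts_choose_mul_θ_pow_le`, `ts_le_T_mul_upper` (= `le_T_mul_bfac`),
-- `ts_T_ge`, `ts_tendsto_T`, `ts_tendsto_upper` (= `tendsto_bfac`); the definitions `θ`, `T`, `bfac` of that file
-- are inlined (generic real `T` in the window lemmas).

/-- Membership in a slice: the edge count is `i`. [folklore] -/
theorem ts_mem_slice {n i : ℕ} {x : Edge n → Bool} : x ∈ slice n i ↔ edgeCount x = i :=
  ⟨fun h => (mem_filter.1 h).2, fun h => mem_filter.2 ⟨mem_univ _, h⟩⟩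

/-- Membership in the error set of `C` on the slice `i`. [folklore] -/
theorem ts_mem_errSet {n k i : ℕ} {C : Circuit (Edge n)} {x : Edge n → Bool} :
    x ∈ errSet n k i C ↔ edgeCount x = i ∧ C.eval x ≠ cliqueFn n k x :=
  ⟨fun h => (mem_filter.1 h).2, fun h => mem_filter.2 ⟨mem_univ _, h⟩⟩

/-- The set attached to a Boolean edge vector is its on-set. [folklore] -/
theorem ts_finsetEquivFun_symm_eq (x : Edge n → Bool) :
    finsetEquivFun.symm x = univ.filter fun e => x e = true := by
  ext e
  simp

/-- `#slice_i = C(C(n,2), i)`. [folklore] -/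
theorem ts_card_slice (n i : ℕ) : #(slice n i) = (n.choose 2).choose i := by
  rw [← card_edgeSet_top_fin n, ← card_univ, ← card_powersetCard]
  refine card_equiv (finsetEquivFun (α := Edge n)).symm fun x => ?_
  simp only [ts_mem_slice, mem_powersetCard, subset_univ, true_and, edgeCount, ts_finsetEquivFun_symm_eq]

/-- A slice `i ≤ C(n,2)` is non-empty. [folklore] -/
theorem ts_card_slice_pos {n i : ℕ} (hi : i ≤ n.choose 2) : 0 < #(slice n i) := by
  rw [ts_card_slice]
  exact Nat.choose_pos hi

/-- The vectors of a slice switching on a fixed edge set `F` number `C(C(n,2) - |F|, i - |F|)`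
(hypergeometric count). [folklore] -/
theorem ts_card_slice_filter_supset (F : Finset (Edge n)) {i : ℕ} (hF : #F ≤ i) :
    #((slice n i).filter fun x => ∀ e ∈ F, x e = true) = (n.choose 2 - #F).choose (i - #F) := by
  rw [← card_edgeSet_top_fin n, ← card_univ (α := Edge n),
    ← Finset.card_filter_powersetCard_subset F univ i (subset_univ F) hF]
  refine card_equiv (finsetEquivFun (α := Edge n)).symm fun x => ?_
  simp only [mem_filter, ts_mem_slice, mem_powersetCard, subset_univ, true_and, edgeCount,
    ts_finsetEquivFun_symm_eq]
  simp only [Finset.subset_iff, mem_filter, mem_univ, true_and]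

/-- **Hypergeometric tail, product form**: `#{x ∈ slice_i : F ⊆ x} · C(n,2)^{|F|} ≤ i^{|F|} · #slice_i`
(`i ≤ C(n,2)`), i.e. `P_i[F ⊆ x] ≤ (i / C(n,2))^{|F|}`. [folklore] -/
theorem ts_card_slice_filter_supset_mul_le (F : Finset (Edge n)) {i : ℕ} (hi : i ≤ n.choose 2) :
    #((slice n i).filter fun x => ∀ e ∈ F, x e = true) * (n.choose 2) ^ #F ≤ i ^ #F * #(slice n i) := by
  by_cases hF : #F ≤ i
  · rw [ts_card_slice_filter_supset F hF, ts_card_slice]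
    exact choose_sub_mul_pow_le_pow_mul_choose #F (n.choose 2) i hF hi
  · have h0 : (slice n i).filter (fun x => ∀ e ∈ F, x e = true) = ∅ := by
      refine filter_eq_empty_iff.2 fun x hx hall => hF ?_
      rw [ts_mem_slice] at hx
      rw [← hx, edgeCount]
      exact card_le_card fun e he => mem_filter.2 ⟨mem_univ _, hall e he⟩
    rw [h0, card_empty, zero_mul]
    exact Nat.zero_le _

/-- The same as a fraction: `P_i[F ⊆ x] ≤ (i / C(n,2))^{|F|}`. [folklore] -/
theorem ts_frac_slice_filter_supset_le (F : Finset (Edge n)) {i : ℕ} (hi : i ≤ n.choose 2)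
    (hN : 0 < n.choose 2) :
    (#((slice n i).filter fun x => ∀ e ∈ F, x e = true) : ℝ) / #(slice n i) ≤
      ((i : ℝ) / n.choose 2) ^ #F := by
  have hs : 0 < #(slice n i) := ts_card_slice_pos hi
  have hN' : (0 : ℝ) < (n.choose 2 : ℝ) ^ #F := by positivity
  rw [div_le_iff₀ (by exact_mod_cast hs), div_pow, div_mul_eq_mul_div, le_div_iff₀ hN']
  exact_mod_cast ts_card_slice_filter_supset_mul_le F hi

/-! ## The first moment `P_i[CLIQUE_k] ≤ C(n,k)·(i/C(n,2))^{C(k,2)}` and the two slice inequalities -/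

/-- `{x ∈ slice_i : CLIQUE_k(x)} ⊆ ⋃_{|A| = k} {x ∈ slice_i : K_A ⊆ x}`. [folklore] -/
theorem ts_filter_clique_subset (n k i : ℕ) :
    (slice n i).filter (fun x => cliqueFn n k x = true) ⊆
      (powersetCard k (univ : Finset (Fin n))).biUnion fun A =>
        (slice n i).filter fun x => ∀ e ∈ univ.filter (fun e => cliqueVec A e = true), x e = true := by
  intro x hx
  rw [mem_filter] at hx
  obtain ⟨hxs, hcl⟩ := hx
  obtain ⟨A, hA, hlive⟩ := (cliqueFn_eq_true_iff_exists k x).1 hcl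
  refine mem_biUnion.2 ⟨A, mem_powersetCard.2 ⟨subset_univ _, hA⟩, mem_filter.2 ⟨hxs, ?_⟩⟩
  intro e he
  exact hlive e ((cliqueVec_eq_true_iff A e).1 (mem_filter.1 he).2)

/-- **First moment on a slice**: `P_i[CLIQUE_k] ≤ C(n,k) · (i/C(n,2))^{C(k,2)}` (union bound over the `C(n,k)`
vertex sets and the hypergeometric tail for the `C(k,2)` edges of each). [folklore] -/
theorem ts_sliceFrac_clique_le {n k i : ℕ} (hi : i ≤ n.choose 2) (hN : 0 < n.choose 2) :
    (#((slice n i).filter fun x => cliqueFn n k x = true) : ℝ) / #(slice n i) ≤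
      (n.choose k : ℝ) * ((i : ℝ) / n.choose 2) ^ k.choose 2 := by
  have hs : 0 < (#(slice n i) : ℝ) := by exact_mod_cast ts_card_slice_pos hi
  set B : Finset (Fin n) → Finset (Edge n → Bool) := fun A =>
    (slice n i).filter fun x => ∀ e ∈ univ.filter (fun e => cliqueVec A e = true), x e = true with hB
  have hcard : #((slice n i).filter fun x => cliqueFn n k x = true) ≤ ∑ A ∈ powersetCard k univ, #(B A) :=
    (card_le_card (ts_filter_clique_subset n k i)).trans card_biUnion_le
  have h2 : ∀ A ∈ powersetCard k (univ : Finset (Fin n)),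
      (#(B A) : ℝ) / #(slice n i) ≤ ((i : ℝ) / n.choose 2) ^ k.choose 2 := by
    intro A hA
    have := ts_frac_slice_filter_supset_le (univ.filter fun e => cliqueVec A e = true) hi hN
    rwa [card_filter_cliqueVec, (mem_powersetCard.1 hA).2] at this
  calc (#((slice n i).filter fun x => cliqueFn n k x = true) : ℝ) / #(slice n i)
      ≤ ((∑ A ∈ powersetCard k univ, #(B A) : ℕ) : ℝ) / #(slice n i) :=
        div_le_div_of_nonneg_right (by exact_mod_cast hcard) hs.le
    _ = ∑ A ∈ powersetCard k univ, (#(B A) : ℝ) / #(slice n i) := by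
        push_cast
        rw [sum_div]
    _ ≤ ∑ _A ∈ powersetCard k (univ : Finset (Fin n)), ((i : ℝ) / n.choose 2) ^ k.choose 2 :=
        sum_le_sum h2
    _ = (n.choose k : ℝ) * ((i : ℝ) / n.choose 2) ^ k.choose 2 := by
        rw [sum_const, card_powersetCard, card_univ, Fintype.card_fin, nsmul_eq_mul]

/-- `P_i[C = 0 ∧ CLIQUE_k = 1] ≤ errfrac_i(C)`: a rejected graph with a `k`-clique is an error of `C`
(any decidability instance; both sides are `0` on an empty slice). [folklore] -/
theorem ts_frac_false_clique_le_errFrac {n k i : ℕ} (C : Circuit (Edge n))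
    {hd : DecidablePred fun y : Edge n → Bool => C.eval y = false ∧ cliqueFn n k y = true} :
    (#((slice n i).filter fun y => C.eval y = false ∧ cliqueFn n k y = true) : ℝ) / #(slice n i) ≤
      (#(errSet n k i C) : ℝ) / #(slice n i) := by
  refine div_le_div_of_nonneg_right ?_ (Nat.cast_nonneg _)
  have hsub : ((slice n i).filter fun y => C.eval y = false ∧ cliqueFn n k y = true) ⊆ errSet n k i C := by
    intro y hy
    simp only [mem_filter, ts_mem_slice, ts_mem_errSet] at hy ⊢
    refine ⟨hy.1, ?_⟩
    rw [hy.2.1, hy.2.2]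
    exact Bool.false_ne_true
  exact_mod_cast card_le_card hsub

/-- On a non-empty slice, `1 − P_i[CLIQUE_k = 1] − errfrac_i(C) ≤ P_i[C = 0]`: a graph of the slice that `C`
accepts is either a `k`-clique graph or an error of `C` against `CLIQUE_k`. [folklore] -/
theorem ts_one_sub_le_frac_false' {n k i : ℕ} (C : Circuit (Edge n))
    {hd : DecidablePred fun x : Edge n → Bool => C.eval x = false} (hs : 0 < #(slice n i)) :
    1 - (#((slice n i).filter fun x => cliqueFn n k x = true) : ℝ) / #(slice n i) -
        (#(errSet n k i C) : ℝ) / #(slice n i) ≤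
      (#((slice n i).filter fun x => C.eval x = false) : ℝ) / #(slice n i) := by
  have hsub : slice n i ⊆ ((slice n i).filter fun x => C.eval x = false) ∪
      (((slice n i).filter fun x => cliqueFn n k x = true) ∪ errSet n k i C) := by
    intro x hx
    rw [mem_union, mem_union]
    by_cases h1 : C.eval x = false
    · exact Or.inl (mem_filter.2 ⟨hx, h1⟩)
    by_cases h2 : cliqueFn n k x = true
    · exact Or.inr (Or.inl (mem_filter.2 ⟨hx, h2⟩))
    refine Or.inr (Or.inr ?_)
    rw [ts_mem_slice] at hx
    refine ts_mem_errSet.2 ⟨hx, fun heq => h1 ?_⟩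
    rw [heq]
    simpa using h2
  have hcard : #(slice n i) ≤ #((slice n i).filter fun x => C.eval x = false) +
      (#((slice n i).filter fun x => cliqueFn n k x = true) + #(errSet n k i C)) :=
    (card_le_card hsub).trans ((card_union_le _ _).trans (add_le_add le_rfl (card_union_le _ _)))
  have hs' : (0 : ℝ) < #(slice n i) := by exact_mod_cast hs
  have h1 : (1 : ℝ) ≤ (#((slice n i).filter fun x => C.eval x = false) : ℝ) / #(slice n i) +
      ((#((slice n i).filter fun x => cliqueFn n k x = true) : ℝ) / #(slice n i) +
        (#(errSet n k i C) : ℝ) / #(slice n i)) := by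
    rw [← add_div, ← add_div, le_div_iff₀ hs', one_mul]
    exact_mod_cast hcard
  linarith

/-- **Rejection on a slice**, first-moment form: for `i ≤ C(n,2)`,
`1 − C(n,k)(i/C(n,2))^{C(k,2)} − errfrac_i(C) ≤ P_i[C = 0]` (any decidability instance). [folklore] -/
theorem ts_one_sub_le_frac_false {n k i : ℕ} (C : Circuit (Edge n))
    {hd : DecidablePred fun x : Edge n → Bool => C.eval x = false} (hi : i ≤ n.choose 2) (hN : 0 < n.choose 2) :
    1 - (n.choose k : ℝ) * ((i : ℝ) / n.choose 2) ^ k.choose 2 - (#(errSet n k i C) : ℝ) / #(slice n i) ≤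
      (#((slice n i).filter fun x => C.eval x = false) : ℝ) / #(slice n i) := by
  have h1 := ts_one_sub_le_frac_false' (k := k) C (hd := hd) (ts_card_slice_pos hi)
  have h2 := ts_sliceFrac_clique_le (k := k) hi hN
  linarith

/-! ## Window bookkeeping around `T_k(n) = C(n,2)·n^{-2/(k-1)}` -/

/-- `C(n,k) · θ^{C(k,2)} ≤ 1/k!` for `θ = n^{-2/(k-1)}` (`θ^{C(k,2)} = n^{-k}` and `C(n,k) ≤ n^k/k!`). [folklore] -/
theorem ts_choose_mul_θ_pow_le {k n : ℕ} (hk : 2 ≤ k) (hn : 1 ≤ n) :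
    (n.choose k : ℝ) * ((n : ℝ) ^ (-(2 : ℝ) / ((k : ℝ) - 1))) ^ k.choose 2 ≤ 1 / k.factorial := by
  have hn0 : (0 : ℝ) < n := by exact_mod_cast hn
  have hk1 : (k : ℝ) - 1 ≠ 0 := by
    have : (2 : ℝ) ≤ k := by exact_mod_cast hk
    linarith
  have hθK : ((n : ℝ) ^ (-(2 : ℝ) / ((k : ℝ) - 1))) ^ k.choose 2 = ((n : ℝ) ^ k)⁻¹ := by
    rw [← Real.rpow_mul_natCast hn0.le, Nat.cast_choose_two, ← Real.rpow_natCast,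
      ← Real.rpow_neg hn0.le]
    congr 1
    field_simp
  have hchoose : (n.choose k : ℝ) ≤ (n : ℝ) ^ k / k.factorial := by
    have := Nat.choose_le_pow_div k n (α := ℝ)
    simpa using this
  rw [hθK]
  calc (n.choose k : ℝ) * ((n : ℝ) ^ k)⁻¹ ≤ (n : ℝ) ^ k / k.factorial * ((n : ℝ) ^ k)⁻¹ :=
        mul_le_mul_of_nonneg_right hchoose (by positivity)
    _ = 1 / k.factorial := by field_simp

/-- `T · T^{-1/4} = T^{3/4}` for `T > 0`. [folklore] -/
theorem ts_mul_rpow_neg_quarter {T : ℝ} (hT : 0 < T) : T * T ^ (-(1 / 4 : ℝ)) = T ^ ((3 : ℝ) / 4) := by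
  conv_lhs => rw [show T * T ^ (-(1 / 4 : ℝ)) = T ^ (1 : ℝ) * T ^ (-(1 / 4 : ℝ)) by rw [Real.rpow_one]]
  rw [← Real.rpow_add hT]
  norm_num

/-- Upper window: `|j - ⌊T⌋₊| ≤ ⌊T⌋₊^{3/4}` and `i ≤ j + w` give `i ≤ T + T^{3/4} + w = T·(1 + T^{-1/4} + w/T)`
(`T > 0`). [folklore] -/
theorem ts_le_T_mul_upper {T : ℝ} {j i w : ℕ} (hT : 0 < T)
    (hj : |(j : ℝ) - (⌊T⌋₊ : ℝ)| ≤ (⌊T⌋₊ : ℝ) ^ ((3 : ℝ) / 4)) (hi : i ≤ j + w) :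
    (i : ℝ) ≤ T * (1 + T ^ (-(1 / 4 : ℝ)) + (w : ℝ) / T) := by
  have hfl : (⌊T⌋₊ : ℝ) ≤ T := Nat.floor_le hT.le
  have hfl' : (⌊T⌋₊ : ℝ) ^ ((3 : ℝ) / 4) ≤ T ^ ((3 : ℝ) / 4) :=
    Real.rpow_le_rpow (Nat.cast_nonneg _) hfl (by norm_num)
  have hj' : (j : ℝ) ≤ ⌊T⌋₊ + (⌊T⌋₊ : ℝ) ^ ((3 : ℝ) / 4) := by
    have := (abs_sub_le_iff.1 hj).1
    linarith
  have hi' : (i : ℝ) ≤ j + w := by exact_mod_cast hi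
  have : T * (1 + T ^ (-(1 / 4 : ℝ)) + (w : ℝ) / T) = T + T ^ ((3 : ℝ) / 4) + w := by
    rw [mul_add, mul_add, mul_one, ts_mul_rpow_neg_quarter hT, mul_div_cancel₀ _ hT.ne']
  rw [this]
  linarith

/-- Lower window: `|j - ⌊T⌋₊| ≤ ⌊T⌋₊^{3/4}` gives `T·(1 − T^{-1/4} − 1/T) = T − T^{3/4} − 1 ≤ j` (`T > 0`).
[folklore] -/
theorem ts_T_mul_lower_le {T : ℝ} {j : ℕ} (hT : 0 < T)
    (hj : |(j : ℝ) - (⌊T⌋₊ : ℝ)| ≤ (⌊T⌋₊ : ℝ) ^ ((3 : ℝ) / 4)) :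
    T * (1 - T ^ (-(1 / 4 : ℝ)) - 1 / T) ≤ j := by
  have hfl : (⌊T⌋₊ : ℝ) ≤ T := Nat.floor_le hT.le
  have hfl1 : T - 1 ≤ (⌊T⌋₊ : ℝ) := by
    have := Nat.lt_floor_add_one T
    linarith
  have hfl' : (⌊T⌋₊ : ℝ) ^ ((3 : ℝ) / 4) ≤ T ^ ((3 : ℝ) / 4) :=
    Real.rpow_le_rpow (Nat.cast_nonneg _) hfl (by norm_num)
  have hj' : (⌊T⌋₊ : ℝ) - (⌊T⌋₊ : ℝ) ^ ((3 : ℝ) / 4) ≤ j := by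
    have := (abs_sub_le_iff.1 hj).2
    linarith
  have : T * (1 - T ^ (-(1 / 4 : ℝ)) - 1 / T) = T - T ^ ((3 : ℝ) / 4) - 1 := by
    rw [mul_sub, mul_sub, mul_one, ts_mul_rpow_neg_quarter hT, mul_one_div_cancel hT.ne']
  rw [this]
  linarith

/-- `T_k(n) = C(n,2)·n^{-2/(k-1)} ≥ (n - 1)/2` for `k ≥ 3` (`n^{-2/(k-1)} ≥ n^{-1}`). [folklore] -/
theorem ts_T_ge {k n : ℕ} (hk : 3 ≤ k) (hn : 1 ≤ n) :
    ((n : ℝ) - 1) / 2 ≤ ((n.choose 2 : ℕ) : ℝ) * (n : ℝ) ^ (-(2 : ℝ) / ((k : ℝ) - 1)) := by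
  have hn1 : (1 : ℝ) ≤ n := by exact_mod_cast hn
  have hk' : (3 : ℝ) ≤ k := by exact_mod_cast hk
  have hθ : (n : ℝ) ^ (-(1 : ℝ)) ≤ (n : ℝ) ^ (-(2 : ℝ) / ((k : ℝ) - 1)) := by
    apply Real.rpow_le_rpow_of_exponent_le hn1
    rw [neg_div, neg_le_neg_iff, div_le_one (by linarith)]
    linarith
  calc ((n : ℝ) - 1) / 2 = ((n.choose 2 : ℕ) : ℝ) * (n : ℝ) ^ (-(1 : ℝ)) := by
        rw [Nat.cast_choose_two, Real.rpow_neg_one]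
        field_simp
    _ ≤ _ := mul_le_mul_of_nonneg_left hθ (Nat.cast_nonneg _)

/-- `T_k(n) → ∞` for `k ≥ 3`. [folklore] -/
theorem ts_tendsto_T {k : ℕ} (hk : 3 ≤ k) :
    Tendsto (fun n : ℕ => ((n.choose 2 : ℕ) : ℝ) * (n : ℝ) ^ (-(2 : ℝ) / ((k : ℝ) - 1))) atTop atTop := by
  have h1 : Tendsto (fun n : ℕ => ((n : ℝ) - 1) / 2) atTop atTop := by
    refine Tendsto.atTop_div_const (by norm_num) ?_
    simpa [sub_eq_add_neg] using tendsto_atTop_add_const_right atTop (-1 : ℝ) tendsto_natCast_atTop_atTop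
  refine tendsto_atTop_mono' atTop ?_ h1
  filter_upwards [eventually_ge_atTop 1] with n hn
  exact ts_T_ge hk hn

/-- Along any `T → ∞` the upper window factor `1 + T^{-1/4} + w/T → 1`. [folklore] -/
theorem ts_tendsto_upper {T : ℕ → ℝ} (hT : Tendsto T atTop atTop) (w : ℕ) :
    Tendsto (fun n => 1 + (T n) ^ (-(1 / 4 : ℝ)) + (w : ℝ) / T n) atTop (𝓝 1) := by
  have h1 : Tendsto (fun n => (T n) ^ (-(1 / 4 : ℝ))) atTop (𝓝 0) :=
    (tendsto_rpow_neg_atTop (by norm_num : (0 : ℝ) < 1 / 4)).comp hT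
  have h2 : Tendsto (fun n => (w : ℝ) / T n) atTop (𝓝 0) := tendsto_const_nhds.div_atTop hT
  have := (tendsto_const_nhds (x := (1 : ℝ))).add h1 |>.add h2
  simpa using this

/-- Along any `T → ∞` the lower window factor `1 − T^{-1/4} − 1/T → 1`. [folklore] -/
theorem ts_tendsto_lower {T : ℕ → ℝ} (hT : Tendsto T atTop atTop) :
    Tendsto (fun n => 1 - (T n) ^ (-(1 / 4 : ℝ)) - 1 / T n) atTop (𝓝 1) := by
  have h1 : Tendsto (fun n => (T n) ^ (-(1 / 4 : ℝ))) atTop (𝓝 0) :=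
    (tendsto_rpow_neg_atTop (by norm_num : (0 : ℝ) < 1 / 4)).comp hT
  have h2 : Tendsto (fun n => (1 : ℝ) / T n) atTop (𝓝 0) := tendsto_const_nhds.div_atTop hT
  have := (tendsto_const_nhds (x := (1 : ℝ))).sub h1 |>.sub h2
  simpa using this

/-- Centrality unfolded: `thr k n = ⌊T_k(n)⌋₊`. [folklore] -/
theorem ts_central_iff {k n j : ℕ} : Central k n j ↔
    |(j : ℝ) - (⌊((n.choose 2 : ℕ) : ℝ) * (n : ℝ) ^ (-(2 : ℝ) / ((k : ℝ) - 1))⌋₊ : ℝ)| ≤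
      (⌊((n.choose 2 : ℕ) : ℝ) * (n : ℝ) ^ (-(2 : ℝ) / ((k : ℝ) - 1))⌋₊ : ℝ) ^ ((3 : ℝ) / 4) :=
  Iff.rfl

/-- **The window package** (registered sub-goal of stub S5 on stmt-PneNP-2834). For `k ≥ 3` and a width `w`,
eventually in `n`: `C(n,2) > 0` and, for every central `j`, `C(k,2) ≤ j` and every `i ≤ j + w` satisfies
`i ≤ C(n,2)` (the slice `i` is non-empty) and the first-moment bound `C(n,k)·(i/C(n,2))^{C(k,2)} ≤ 1/3`
(`= (1+o(1))/k! ≤ 2/k!`). [folklore] -/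
theorem ts_eventually_window :
    ∀ k : ℕ, 3 ≤ k → ∀ w : ℕ, ∀ᶠ n : ℕ in atTop, 0 < n.choose 2 ∧ ∀ j : ℕ, Central k n j →
      k.choose 2 ≤ j ∧ ∀ i : ℕ, i ≤ j + w →
        i ≤ n.choose 2 ∧ (n.choose k : ℝ) * ((i : ℝ) / n.choose 2) ^ k.choose 2 ≤ 1 / 3 := by
  intro k hk w
  obtain ⟨T, hTdef⟩ : ∃ T : ℕ → ℝ, ∀ n : ℕ,
      T n = ((n.choose 2 : ℕ) : ℝ) * (n : ℝ) ^ (-(2 : ℝ) / ((k : ℝ) - 1)) := ⟨_, fun _ => rfl⟩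
  have hT : Tendsto T atTop atTop := (ts_tendsto_T hk).congr fun n => (hTdef n).symm
  have hθ : Tendsto (fun n : ℕ => (n : ℝ) ^ (-(2 : ℝ) / ((k : ℝ) - 1))) atTop (𝓝 0) :=
    tendsto_rpow_threshold (k := k) (by omega)
  have hU := ts_tendsto_upper hT w
  have hUK := hU.pow (k.choose 2)
  have hLo := ts_tendsto_lower hT
  rw [one_pow] at hUK
  have e1 : ∀ᶠ n : ℕ in atTop, 1 ≤ T n := hT.eventually_ge_atTop 1
  have e2 : ∀ᶠ n : ℕ in atTop, (n : ℝ) ^ (-(2 : ℝ) / ((k : ℝ) - 1)) < 1 / 2 :=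
    (tendsto_order.1 hθ).2 _ (by norm_num)
  have e3 : ∀ᶠ n : ℕ in atTop, 1 + (T n) ^ (-(1 / 4 : ℝ)) + (w : ℝ) / T n < 2 :=
    (tendsto_order.1 hU).2 _ (by norm_num)
  have e4 : ∀ᶠ n : ℕ in atTop, (1 + (T n) ^ (-(1 / 4 : ℝ)) + (w : ℝ) / T n) ^ k.choose 2 < 2 :=
    (tendsto_order.1 hUK).2 _ (by norm_num)
  have e5 : ∀ᶠ n : ℕ in atTop, (1 / 2 : ℝ) < 1 - (T n) ^ (-(1 / 4 : ℝ)) - 1 / T n :=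
    (tendsto_order.1 hLo).1 _ (by norm_num)
  have e6 : ∀ᶠ n : ℕ in atTop, (2 * k.choose 2 : ℝ) ≤ T n := hT.eventually_ge_atTop _
  filter_upwards [e1, e2, e3, e4, e5, e6, eventually_ge_atTop 2] with n h1 h2 h3 h4 h5 h6 hn2
  have hN : 0 < n.choose 2 := Nat.choose_pos hn2
  have hNr : (0 : ℝ) < n.choose 2 := by exact_mod_cast hN
  have hT0 : 0 < T n := by linarith
  have hk6 : (6 : ℝ) ≤ k.factorial := by exact_mod_cast (Nat.factorial_le hk : (3 : ℕ).factorial ≤ _)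
  refine ⟨hN, fun j hj => ?_⟩
  have hj' := ts_central_iff.1 hj
  rw [← hTdef n] at hj'
  refine ⟨?_, fun i hi => ?_⟩
  · -- `C(k,2) ≤ T/2 ≤ T (1 - T^{-1/4} - 1/T) ≤ j`
    have hlow := ts_T_mul_lower_le hT0 hj'
    have : (k.choose 2 : ℝ) ≤ j := by
      calc (k.choose 2 : ℝ) ≤ T n * (1 / 2) := by linarith
        _ ≤ T n * (1 - (T n) ^ (-(1 / 4 : ℝ)) - 1 / T n) := mul_le_mul_of_nonneg_left h5.le hT0.le
        _ ≤ j := hlow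
    exact_mod_cast this
  · have hup := ts_le_T_mul_upper hT0 hj' hi
    have hb0 : 0 ≤ 1 + (T n) ^ (-(1 / 4 : ℝ)) + (w : ℝ) / T n := by
      have : 0 ≤ (T n) ^ (-(1 / 4 : ℝ)) := Real.rpow_nonneg hT0.le _
      have : 0 ≤ (w : ℝ) / T n := div_nonneg (Nat.cast_nonneg _) hT0.le
      linarith
    have hθ0 : 0 ≤ (n : ℝ) ^ (-(2 : ℝ) / ((k : ℝ) - 1)) := Real.rpow_nonneg (Nat.cast_nonneg _) _
    constructor
    · -- `i ≤ T b ≤ 2T = 2 C(n,2) θ ≤ C(n,2)`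
      have : (i : ℝ) ≤ n.choose 2 := by
        calc (i : ℝ) ≤ T n * (1 + (T n) ^ (-(1 / 4 : ℝ)) + (w : ℝ) / T n) := hup
          _ ≤ T n * 2 := mul_le_mul_of_nonneg_left h3.le hT0.le
          _ = (n.choose 2 : ℝ) * (2 * (n : ℝ) ^ (-(2 : ℝ) / ((k : ℝ) - 1))) := by rw [hTdef n]; ring
          _ ≤ (n.choose 2 : ℝ) * 1 := mul_le_mul_of_nonneg_left (by linarith) hNr.le
          _ = n.choose 2 := mul_one _
      exact_mod_cast this
    · -- first moment: `C(n,k)(i/N)^K ≤ C(n,k) θ^K b^K ≤ b^K/k! ≤ 2/6`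
      have hq : (i : ℝ) / n.choose 2 ≤
          (n : ℝ) ^ (-(2 : ℝ) / ((k : ℝ) - 1)) * (1 + (T n) ^ (-(1 / 4 : ℝ)) + (w : ℝ) / T n) := by
        rw [div_le_iff₀ hNr]
        calc (i : ℝ) ≤ T n * (1 + (T n) ^ (-(1 / 4 : ℝ)) + (w : ℝ) / T n) := hup
          _ = (n : ℝ) ^ (-(2 : ℝ) / ((k : ℝ) - 1)) * (1 + (T n) ^ (-(1 / 4 : ℝ)) + (w : ℝ) / T n) *
                n.choose 2 := by rw [hTdef n]; ring
      have hq0 : (0 : ℝ) ≤ (i : ℝ) / n.choose 2 := by positivity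
      calc (n.choose k : ℝ) * ((i : ℝ) / n.choose 2) ^ k.choose 2
          ≤ (n.choose k : ℝ) * ((n : ℝ) ^ (-(2 : ℝ) / ((k : ℝ) - 1)) *
              (1 + (T n) ^ (-(1 / 4 : ℝ)) + (w : ℝ) / T n)) ^ k.choose 2 :=
            mul_le_mul_of_nonneg_left (pow_le_pow_left₀ hq0 hq _) (Nat.cast_nonneg _)
        _ = (n.choose k : ℝ) * ((n : ℝ) ^ (-(2 : ℝ) / ((k : ℝ) - 1))) ^ k.choose 2 *
              (1 + (T n) ^ (-(1 / 4 : ℝ)) + (w : ℝ) / T n) ^ k.choose 2 := by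
            rw [mul_pow]; ring
        _ ≤ 1 / k.factorial * (1 + (T n) ^ (-(1 / 4 : ℝ)) + (w : ℝ) / T n) ^ k.choose 2 :=
            mul_le_mul_of_nonneg_right (ts_choose_mul_θ_pow_le (by omega) (by omega)) (pow_nonneg hb0 _)
        _ ≤ 1 / k.factorial * 2 := mul_le_mul_of_nonneg_left h4.le (by positivity)
        _ ≤ 1 / 6 * 2 :=
            mul_le_mul_of_nonneg_right (one_div_le_one_div_of_le (by norm_num) hk6) (by norm_num)
        _ = 1 / 3 := by norm_num

end Summit.PneNP.PneNP.Cruxes.ConstantBand.FlatPriorRelativeMinterms
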